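import Literature.AlgebraicGeometry.Resolution.AlterationsNormalFormBlowupFormal
import Literature.AlgebraicGeometry.Resolution.PowerSeriesRegularLocal
import Literature.AlgebraicGeometry.Resolution.NodalPowRingSingularLocus
import Literature.AlgebraicGeometry.Resolution.NagataCriterion
import HarnessLib

/-!
# The singular locus of the formal model `k⟦u, v, t₁, …, t_m⟧/(uv - t₁ ⋯ t_s)` of de Jong 4.25 (ii)

Topic: `Literature/AlgebraicGeometry/Resolution`. The commutative algebra behind the first
sentence of the proof of de Jong 1996, Claim 4.27 ("Since `E` is smooth, its ideal in the rings
of (ii) is given by `(u, v, t₁, t₂)` after renumbering", p. 75) and behind 3.5 ("`Sing(X)` has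
pure codimension three in `X`", p. 64): **the singular locus of
`A = k⟦u, v, t₁, …, t_m⟧/(uv - t₁ ⋯ t_s)` (`DeJong1996.NodalFamilyRing k m s`, `2 ≤ s ≤ m`) is the
union of the `V(𝔭_{ab})`, `𝔭_{ab} = (u, v, t_a, t_b)` (`DeJong1996.nodalCentreIdeal`), `a < b ≤ s`.**
Everything is PROVED, on the tree's power series algebra (`PowerSeriesRegularLocal.lean`: `k⟦X⟧`
is a regular ring, the partial derivatives `MvPowerSeries.pderiv`, the Jacobian necessary
condition `Derivation.apply_mem_comap_of_not_isRegularLocalRing` and the converse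
`not_isRegularLocalRing_localization_quotient_of_mem_sq`; `NodalPowRingSingularLocus.lean`:
ideals generated by variables are prime; `NagataCriterion.lean`: the regular locus is stable
under generalization):

* `DeJong1996.pderiv_inl_zero_nodalFamilyRelation` etc. — `∂F/∂u = v`, `∂F/∂v = u`,
  `∂F/∂t_c = -∏_{i≠c, i<s} tᵢ` for `F = uv - t₁ ⋯ t_s`.
* `DeJong1996.nodalCentrePreimage` — the ideal `𝔓_{ab} = (u, v, t_a, t_b)` of `k⟦u, v, t⟧`; it is
  prime, contains `F` in its square (for `a ≠ b < s`), and maps onto / pulls back from `𝔭_{ab}`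
  (`map_mk_nodalCentrePreimage`, `comap_mk_nodalCentreIdeal`); so `𝔭_{ab}` is prime
  (`isPrime_nodalCentreIdeal`) and determines `{a, b}` (`eq_of_nodalCentreIdeal_le`:
  `𝔭_{ab} ≤ 𝔭_{a'b'}` with `a < b`, `a' < b'` forces `(a, b) = (a', b')`).
* `DeJong1996.not_isRegularLocalRing_of_nodalCentreIdeal_le` — **`V(𝔭_{ab}) ⊆ Sing(A)`**:
  `0 ≠ F ∈ 𝔓_{ab}²`, so `A_{𝔭_{ab}}` is not regular, and neither is `A_𝔮` for `𝔮 ⊇ 𝔭_{ab}`.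
* `DeJong1996.exists_nodalCentreIdeal_le_of_not_isRegularLocalRing` — **`Sing(A) ⊆ ⋃ V(𝔭_{ab})`**:
  if `A_𝔮` is not regular, all partial derivatives of `F` lie in the preimage `Q` of `𝔮`, i.e.
  `u, v ∈ Q` and, for every `c < s`, `∏_{i≠c} tᵢ ∈ Q`; as `s ≥ 2` this puts two distinct
  `t_a, t_b` (`a, b < s`) in `Q`.

## Sources

* A. J. de Jong, *Smoothness, semi-stability and alterations*, Publ. Math. IHÉS 83 (1996):
  3.5 (p. 64), 4.25 (ii) and 4.27 (pp. 75–76). [DeJong1996]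
* The Stacks Project, Tag 07PF; H. Matsumura, *Commutative Ring Theory* (1986), Thm. 14.2,
  Thm. 19.3 — through the files quoted above.
-/

noncomputable section

open IsLocalRing MvPowerSeries

namespace Literature.AlgebraicGeometry.Resolution

universe u

namespace DeJong1996

variable (k : Type u) [Field k] (m s : ℕ)

/-! ## Partial derivatives of the relation `F = uv - t₁ ⋯ t_s` -/

/-- `∂F/∂u = v`. [folklore] -/
theorem pderiv_inl_zero_nodalFamilyRelation :
    MvPowerSeries.pderiv (Sum.inl 0) (nodalFamilyRelation k m s) = MvPowerSeries.X (Sum.inl 1) := by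
  classical
  rw [nodalFamilyRelation, map_sub, Derivation.leibniz, MvPowerSeries.pderiv_X,
    MvPowerSeries.pderiv_X, if_pos rfl, if_neg (by simp),
    MvPowerSeries.pderiv_prod_X_eq_zero _ _ (fun j _ => Sum.inr_ne_inl)]
  simp

/-- `∂F/∂v = u`. [folklore] -/
theorem pderiv_inl_one_nodalFamilyRelation :
    MvPowerSeries.pderiv (Sum.inl 1) (nodalFamilyRelation k m s) = MvPowerSeries.X (Sum.inl 0) := by
  classical
  rw [nodalFamilyRelation, map_sub, Derivation.leibniz, MvPowerSeries.pderiv_X,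
    MvPowerSeries.pderiv_X, if_pos rfl, if_neg (by simp),
    MvPowerSeries.pderiv_prod_X_eq_zero _ _ (fun j _ => Sum.inr_ne_inl)]
  simp

/-- `∂F/∂t_c = -∏_{i ≠ c, i < s} tᵢ` for `c < s`. [folklore] -/
theorem pderiv_inr_nodalFamilyRelation (c : Fin m) (hc : c.val < s) :
    MvPowerSeries.pderiv (Sum.inr c) (nodalFamilyRelation k m s) =
      -∏ i ∈ (Finset.univ.filter (fun i : Fin m => i.val < s)).erase c,
        MvPowerSeries.X (Sum.inr i) := by
  classical
  rw [nodalFamilyRelation, map_sub, Derivation.leibniz, MvPowerSeries.pderiv_X,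
    MvPowerSeries.pderiv_X, if_neg (by simp), if_neg (by simp), smul_zero, smul_zero, add_zero,
    zero_sub, MvPowerSeries.pderiv_prod_X _ Sum.inr (Sum.inr_injective.injOn)
      (Finset.mem_filter.mpr ⟨Finset.mem_univ c, hc⟩)]

/-! ## The primes `𝔓_{ab} = (u, v, t_a, t_b)` of `k⟦u, v, t⟧` and `𝔭_{ab}` of `A` -/

/-- The set of variables `{u, v, t_a, t_b}`. [folklore] -/
def centreVars (a b : Fin m) : Finset (Fin 2 ⊕ Fin m) :=
  {Sum.inl 0, Sum.inl 1, Sum.inr a, Sum.inr b}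

/-- The ideal `𝔓_{ab} = (u, v, t_a, t_b)` of `k⟦u, v, t₁, …, t_m⟧`, preimage of `𝔭_{ab}`.
[cite: DeJong1996, 4.27, p. 75] -/
def nodalCentrePreimage (a b : Fin m) : Ideal (MvPowerSeries (Fin 2 ⊕ Fin m) k) :=
  Ideal.span ((fun c => (MvPowerSeries.X c : MvPowerSeries (Fin 2 ⊕ Fin m) k)) ''
    (centreVars m a b : Set (Fin 2 ⊕ Fin m)))

variable {m} in
/-- The variables `u, v, t_a, t_b` lie in `𝔓_{ab}`. [folklore] -/
theorem X_mem_nodalCentrePreimage {a b : Fin m} {c : Fin 2 ⊕ Fin m} (hc : c ∈ centreVars m a b) :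
    (MvPowerSeries.X c : MvPowerSeries (Fin 2 ⊕ Fin m) k) ∈ nodalCentrePreimage k m a b :=
  Ideal.subset_span ⟨c, hc, rfl⟩

variable {m} in
/-- `centreVars` is the complement of the range of the inclusion of the other indices.
[folklore] -/
theorem mem_centreVars_iff_notMem_range (a b : Fin m) (c : Fin 2 ⊕ Fin m) :
    c ∈ centreVars m a b ↔
      c ∉ Set.range (Function.Embedding.subtype fun c : Fin 2 ⊕ Fin m => c ∉ centreVars m a b) := by
  constructor
  · rintro hc ⟨⟨c', hc'⟩, rfl⟩
    exact hc' hc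
  · intro hc
    by_contra h
    exact hc ⟨⟨c, h⟩, rfl⟩

/-- `𝔓_{ab}` is a prime ideal (an ideal generated by variables, `MvPowerSeries.isPrime_span_X_image`).
[folklore] -/
theorem isPrime_nodalCentrePreimage (a b : Fin m) : (nodalCentrePreimage k m a b).IsPrime := by
  haveI : IsDomain (MvPowerSeries (Fin 2 ⊕ Fin m) k) := NoZeroDivisors.to_isDomain _
  exact MvPowerSeries.isPrime_span_X_image _ (centreVars m a b) (mem_centreVars_iff_notMem_range a b)

/-- **`F ∈ 𝔓_{ab}²`** for `a ≠ b`, `a, b < s`: `uv ∈ 𝔓²` and `t_a t_b` divides `t₁ ⋯ t_s`.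
[cite: DeJong1996, 4.27, p. 75] -/
theorem nodalFamilyRelation_mem_sq {a b : Fin m} (hab : a ≠ b) (ha : a.val < s) (hb : b.val < s) :
    nodalFamilyRelation k m s ∈ nodalCentrePreimage k m a b ^ 2 := by
  classical
  rw [nodalFamilyRelation, pow_two]
  refine Ideal.sub_mem _ (Ideal.mul_mem_mul (X_mem_nodalCentrePreimage k (by simp [centreVars]))
    (X_mem_nodalCentrePreimage k (by simp [centreVars]))) ?_
  have ha' : a ∈ Finset.univ.filter (fun i : Fin m => i.val < s) := by simp [ha]
  have hb' : b ∈ (Finset.univ.filter (fun i : Fin m => i.val < s)).erase a :=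
    Finset.mem_erase.mpr ⟨fun h => hab h.symm, by simp [hb]⟩
  rw [← Finset.mul_prod_erase _ _ ha', ← Finset.mul_prod_erase _ _ hb', ← mul_assoc]
  exact Ideal.mul_mem_right _ _ (Ideal.mul_mem_mul
    (X_mem_nodalCentrePreimage k (by simp [centreVars]))
    (X_mem_nodalCentrePreimage k (by simp [centreVars])))

/-- `F ∈ 𝔓_{ab}` for `a ≠ b`, `a, b < s`. [folklore] -/
theorem nodalFamilyRelation_mem {a b : Fin m} (hab : a ≠ b) (ha : a.val < s) (hb : b.val < s) :
    nodalFamilyRelation k m s ∈ nodalCentrePreimage k m a b :=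
  Ideal.pow_le_self two_ne_zero (nodalFamilyRelation_mem_sq k m s hab ha hb)

/-- `𝔓_{ab}` maps onto `𝔭_{ab}` under `k⟦u, v, t⟧ → A`. [folklore] -/
theorem map_mk_nodalCentrePreimage (a b : Fin m) :
    (nodalCentrePreimage k m a b).map (Ideal.Quotient.mk (Ideal.span {nodalFamilyRelation k m s})) =
      nodalCentreIdeal k m s a b := by
  classical
  rw [nodalCentrePreimage, Ideal.map_span, nodalCentreIdeal, ← Set.image_comp]
  congr 1
  simp only [centreVars, Finset.coe_insert, Finset.coe_singleton, Set.image_insert_eq,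
    Set.image_singleton, Function.comp_apply]
  rfl

/-- `𝔭_{ab}` pulls back to `𝔓_{ab}` (which contains `F`). [folklore] -/
theorem comap_mk_nodalCentreIdeal {a b : Fin m} (hab : a ≠ b) (ha : a.val < s) (hb : b.val < s) :
    (nodalCentreIdeal k m s a b).comap (Ideal.Quotient.mk (Ideal.span {nodalFamilyRelation k m s})) =
      nodalCentrePreimage k m a b := by
  rw [← map_mk_nodalCentrePreimage, Ideal.comap_map_of_surjective _ Ideal.Quotient.mk_surjective,
    ← RingHom.ker_eq_comap_bot, Ideal.mk_ker, sup_eq_left]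
  rw [Ideal.span_le, Set.singleton_subset_iff]
  exact nodalFamilyRelation_mem k m s hab ha hb

/-- **`𝔭_{ab}` is a prime ideal of `A`** (`a ≠ b`, `a, b < s`). [cite: DeJong1996, 4.27, p. 75] -/
theorem isPrime_nodalCentreIdeal {a b : Fin m} (hab : a ≠ b) (ha : a.val < s) (hb : b.val < s) :
    (nodalCentreIdeal k m s a b).IsPrime := by
  rw [← map_mk_nodalCentrePreimage]
  haveI := isPrime_nodalCentrePreimage k m a b
  refine Ideal.map_isPrime_of_surjective Ideal.Quotient.mk_surjective ?_
  rw [Ideal.mk_ker, Ideal.span_le, Set.singleton_subset_iff]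
  exact nodalFamilyRelation_mem k m s hab ha hb

/-- A variable lies in `𝔓_{ab}` only if it is one of `u, v, t_a, t_b`. [folklore] -/
theorem X_mem_nodalCentrePreimage_iff {a b : Fin m} {c : Fin 2 ⊕ Fin m} :
    (MvPowerSeries.X c : MvPowerSeries (Fin 2 ⊕ Fin m) k) ∈ nodalCentrePreimage k m a b ↔
      c ∈ centreVars m a b := by
  classical
  refine ⟨fun h => ?_, X_mem_nodalCentrePreimage k⟩
  by_contra hc
  -- kill the variables of `centreVars`: `X_c` survives, the ideal dies
  let τ := {c : Fin 2 ⊕ Fin m // c ∉ centreVars m a b}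
  let e : τ ↪ Fin 2 ⊕ Fin m := Function.Embedding.subtype _
  have hker := MvPowerSeries.ker_killCompl_eq_span (R := k) e (centreVars m a b)
    (mem_centreVars_iff_notMem_range a b)
  have h1 : (MvPowerSeries.X c : MvPowerSeries (Fin 2 ⊕ Fin m) k) ∈
      RingHom.ker (MvPowerSeries.killCompl (R := k) e).toRingHom := by
    rw [hker]
    exact h
  rw [RingHom.mem_ker] at h1
  have h2 : MvPowerSeries.killCompl (R := k) e (MvPowerSeries.X (e ⟨c, hc⟩)) =
      MvPowerSeries.X ⟨c, hc⟩ :=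
    MvPowerSeries.killCompl_X _
  change MvPowerSeries.killCompl e (MvPowerSeries.X c) = 0 at h1
  rw [show (e ⟨c, hc⟩ : Fin 2 ⊕ Fin m) = c from rfl, h1] at h2
  have h3 := congrArg (MvPowerSeries.coeff (Finsupp.single (⟨c, hc⟩ : τ) 1)) h2
  classical
  simp [MvPowerSeries.coeff_X] at h3

/-- **`𝔭_{ab}` determines the pair**: for `a < b < s` and `a' < b' < s`, `𝔭_{ab} ≤ 𝔭_{a'b'}`
forces `(a, b) = (a', b')`. [folklore] -/
theorem eq_of_nodalCentreIdeal_le {a b a' b' : Fin m} (hab : a < b) (hb : b.val < s)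
    (hab' : a' < b') (hb' : b'.val < s)
    (h : nodalCentreIdeal k m s a b ≤ nodalCentreIdeal k m s a' b') : a = a' ∧ b = b' := by
  have ha : a.val < s := lt_trans hab hb
  have ha' : a'.val < s := lt_trans hab' hb'
  have h' : nodalCentrePreimage k m a b ≤ nodalCentrePreimage k m a' b' := by
    rw [← comap_mk_nodalCentreIdeal k m s hab.ne ha hb, ← comap_mk_nodalCentreIdeal k m s hab'.ne ha' hb']
    exact Ideal.comap_mono h
  have hta : Sum.inr a ∈ centreVars m a' b' :=
    (X_mem_nodalCentrePreimage_iff k m).mp (h' (X_mem_nodalCentrePreimage k (by simp [centreVars])))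
  have htb : Sum.inr b ∈ centreVars m a' b' :=
    (X_mem_nodalCentrePreimage_iff k m).mp (h' (X_mem_nodalCentrePreimage k (by simp [centreVars])))
  simp only [centreVars, Finset.mem_insert, Finset.mem_singleton, reduceCtorEq, Sum.inr.injEq,
    false_or] at hta htb
  rcases hta with rfl | rfl <;> rcases htb with h1 | h1
  · exact absurd h1 hab.ne'
  · exact ⟨rfl, h1⟩
  · subst h1
    exact absurd (hab.trans hab') (lt_irrefl _)
  · subst h1
    exact absurd hab (lt_irrefl _)

/-! ## `V(𝔭_{ab}) ⊆ Sing(A)` -/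

/-- The relation is non-zero (its `uv`-coefficient is `1`). [folklore] -/
theorem nodalFamilyRelation_ne_zero (hs : 1 ≤ s) (hsm : s ≤ m) : nodalFamilyRelation k m s ≠ 0 := by
  classical
  intro h
  have := congrArg (MvPowerSeries.coeff (Finsupp.single (Sum.inl 0) 1 + Finsupp.single (Sum.inl 1) 1)) h
  rw [nodalFamilyRelation, map_sub, map_zero, MvPowerSeries.X, MvPowerSeries.X,
    MvPowerSeries.monomial_mul_monomial, MvPowerSeries.coeff_monomial_same, mul_one] at this
  -- the product of the `t`'s has a non-zero exponent at `t₀`, so its `uv`-coefficient vanishes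
  have h0 : MvPowerSeries.coeff (Finsupp.single (Sum.inl 0) 1 + Finsupp.single (Sum.inl 1) 1)
      (∏ i ∈ Finset.univ.filter (fun i : Fin m => i.val < s),
        (MvPowerSeries.X (Sum.inr i) : MvPowerSeries (Fin 2 ⊕ Fin m) k)) = 0 := by
    simp only [MvPowerSeries.X]
    rw [MvPowerSeries.prod_monomial_one, MvPowerSeries.coeff_monomial, if_neg]
    intro heq
    have i0 : (⟨0, by omega⟩ : Fin m) ∈ Finset.univ.filter (fun i : Fin m => i.val < s) := by
      simp; omega
    have := DFunLike.congr_fun heq (Sum.inr ⟨0, by omega⟩)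
    simp only [Finsupp.coe_add, Pi.add_apply, Finsupp.single_apply, reduceCtorEq, if_false,
      add_zero, Finsupp.coe_finsetSum, Finset.sum_apply] at this
    rw [Finset.sum_eq_single (⟨0, by omega⟩ : Fin m)] at this
    · simp at this
    · intro b _ hb
      simp [hb]
    · intro h
      exact absurd i0 h
  rw [h0, sub_zero] at this
  exact one_ne_zero this

/-- **`V(𝔭_{ab}) ⊆ Sing(A)`**: for `a ≠ b`, `a, b < s` (`s ≤ m`) and a prime `𝔮 ⊇ 𝔭_{ab}` of
`A = k⟦u, v, t⟧/(F)`, the local ring `A_𝔮` is not regular — `A_{𝔭_{ab}} = k⟦u, v, t⟧_{𝔓_{ab}}/(F)`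
with `0 ≠ F ∈ 𝔓_{ab}²` is not regular (`not_isRegularLocalRing_localization_quotient_of_mem_sq`),
and the regular locus is stable under generalization. [cite: DeJong1996, 4.27, pp. 75–76] -/
theorem not_isRegularLocalRing_of_nodalCentreIdeal_le (hsm : s ≤ m) {a b : Fin m} (hab : a ≠ b)
    (ha : a.val < s) (hb : b.val < s) (𝔮 : Ideal (NodalFamilyRing k m s)) [𝔮.IsPrime]
    (hle : nodalCentreIdeal k m s a b ≤ 𝔮) :
    ¬ IsRegularLocalRing (Localization.AtPrime 𝔮) := by
  haveI := isPrime_nodalCentreIdeal k m s hab ha hb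
  haveI : IsRegularRing (MvPowerSeries (Fin 2 ⊕ Fin m) k) := isRegularRing_mvPowerSeries k _
  haveI : IsDomain (MvPowerSeries (Fin 2 ⊕ Fin m) k) := NoZeroDivisors.to_isDomain _
  have h𝔭 : ¬ IsRegularLocalRing (Localization.AtPrime (nodalCentreIdeal k m s a b)) := by
    refine not_isRegularLocalRing_localization_quotient_of_mem_sq
      (nodalFamilyRelation_ne_zero k m s (by omega) hsm) (nodalCentreIdeal k m s a b) ?_
    rw [comap_mk_nodalCentreIdeal k m s hab ha hb]
    exact nodalFamilyRelation_mem_sq k m s hab ha hb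
  intro hreg
  apply h𝔭
  have := mem_regularLocus_of_le (A := NodalFamilyRing k m s) (P := ⟨𝔮, ‹_›⟩)
    (Q := ⟨nodalCentreIdeal k m s a b, ‹_›⟩) hle ((mem_regularLocus _).mpr hreg)
  exact (mem_regularLocus _).mp this

/-! ## `Sing(A) ⊆ ⋃ V(𝔭_{ab})` -/

/-- **`Sing(A) ⊆ ⋃_{a<b≤s} V(𝔭_{ab})`**: if `A_𝔮` is not regular (`2 ≤ s`), then
`𝔭_{ab} ⊆ 𝔮` for some `a < b < s` (0-indexed). By the Jacobian necessary condition all partial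
derivatives of `F = uv - t₁ ⋯ t_s` lie in the preimage `Q` of `𝔮`: `v, u ∈ Q`, and
`∏_{i ≠ c, i < s} tᵢ ∈ Q` for every `c < s`; with `c = t₁` this gives some `t_a ∈ Q`, `a ≠ 1`… more
precisely some `t_a ∈ Q`, and then with `c = a` some `t_b ∈ Q`, `b ≠ a`.
[cite: DeJong1996, 4.27, pp. 75–76] -/
theorem exists_nodalCentreIdeal_le_of_not_isRegularLocalRing (hs : 2 ≤ s) (hsm : s ≤ m)
    (𝔮 : Ideal (NodalFamilyRing k m s)) [𝔮.IsPrime]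
    (h𝔮 : ¬ IsRegularLocalRing (Localization.AtPrime 𝔮)) :
    ∃ a b : Fin m, a < b ∧ b.val < s ∧ nodalCentreIdeal k m s a b ≤ 𝔮 := by
  classical
  haveI : IsRegularRing (MvPowerSeries (Fin 2 ⊕ Fin m) k) := isRegularRing_mvPowerSeries k _
  set Q : Ideal (MvPowerSeries (Fin 2 ⊕ Fin m) k) :=
    𝔮.comap (Ideal.Quotient.mk (Ideal.span {nodalFamilyRelation k m s})) with hQ
  haveI : Q.IsPrime := Ideal.comap_isPrime _ 𝔮
  have hD : ∀ c, MvPowerSeries.pderiv c (nodalFamilyRelation k m s) ∈ Q := fun c =>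
    Derivation.apply_mem_comap_of_not_isRegularLocalRing _ _ 𝔮 h𝔮
  have hu : (MvPowerSeries.X (Sum.inl 0) : MvPowerSeries (Fin 2 ⊕ Fin m) k) ∈ Q := by
    simpa [pderiv_inl_one_nodalFamilyRelation] using hD (Sum.inl 1)
  have hv : (MvPowerSeries.X (Sum.inl 1) : MvPowerSeries (Fin 2 ⊕ Fin m) k) ∈ Q := by
    simpa [pderiv_inl_zero_nodalFamilyRelation] using hD (Sum.inl 0)
  -- for every `c < s`, some `t_i ∈ Q` with `i ≠ c`, `i < s`
  have ht : ∀ c : Fin m, c.val < s → ∃ i : Fin m, i ≠ c ∧ i.val < s ∧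
      (MvPowerSeries.X (Sum.inr i) : MvPowerSeries (Fin 2 ⊕ Fin m) k) ∈ Q := by
    intro c hc
    have h1 := hD (Sum.inr c)
    rw [pderiv_inr_nodalFamilyRelation k m s c hc, neg_mem_iff] at h1
    obtain ⟨i, hi, hiQ⟩ := Ideal.IsPrime.prod_mem_iff.mp h1
    exact ⟨i, (Finset.mem_erase.mp hi).1, (Finset.mem_filter.mp (Finset.mem_erase.mp hi).2).2, hiQ⟩
  obtain ⟨a, -, ha, haQ⟩ := ht ⟨0, by omega⟩ (by simp; omega)
  obtain ⟨b, hba, hb, hbQ⟩ := ht a ha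
  -- order the pair
  have key : ∀ a b : Fin m, a < b → b.val < s →
      (MvPowerSeries.X (Sum.inr a) : MvPowerSeries (Fin 2 ⊕ Fin m) k) ∈ Q →
      (MvPowerSeries.X (Sum.inr b) : MvPowerSeries (Fin 2 ⊕ Fin m) k) ∈ Q →
        nodalCentreIdeal k m s a b ≤ 𝔮 := by
    intro a b _ _ haQ hbQ
    rw [nodalCentreIdeal, Ideal.span_le]
    rintro z (rfl | rfl | rfl | rfl)
    · exact hu
    · exact hv
    · exact haQ
    · exact hbQ
  rcases lt_or_gt_of_ne hba with h | h
  · exact ⟨b, a, h, ha, key b a h ha hbQ haQ⟩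
  · exact ⟨a, b, h, hb, key a b h hb haQ hbQ⟩

end DeJong1996

end Literature.AlgebraicGeometry.Resolution

end
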